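import Summits.QuantumFields.YangMills.Theorems.SwapVirialDeficitBlowUpGnomonicFibreRescaledFloors
import Summits.QuantumFields.YangMills.Theorems.SwapVirialDeficitSectorLaplaceMbDensityPointwise
import Summits.QuantumFields.YangMills.Theorems.SwapVirialDeficitQuantitativeLaplaceDiagonalRescaleChart
import Literature.Analysis.Asymptotics.LaplaceMethodChartComposition
import HarnessLib

/-!
# THE RESCALED BULK SOCKETS OF THE GNOMONIC FIBRE — the chart `Ψ′(p,y) = gnoFibreEquiv (p, gnoScale p y)`, its tube chart identity, and the packaged sockets
# (free-hands support of ⟨stmt-QuantumFields-24197⟩ `SwapVirialDeficit.SwapGluedStiffness` ∕ ⟨24194⟩; cell ym-idea-1, (S)-road option E1, stub S2∞ = S2 ∪ S5c)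

Second half of the rescaled sockets (first half: ✓`…BlowUpGnomonicFibreRescaledFloors` — uniform coercivity `fibQ_gnoScale_ge` and far floor `farFloor_gnoScale`):
* §3 the rescaled chart `Ψ′(p,y) = gnoFibreEquiv (p, gnoScale p y)`: `measurable_gnoScaleChart`, `gnoScaleChart_injective`, `gnoScaleChart_surjective`;
  ★ `volume_gnoDensity_restrict_scaledTube_eq_map` — its TUBE CHART IDENTITY over any measurable base set `S`, density `(Π_i|c_i(p)|)·ρ(Ψ′(p,y))`
  (lit ✓`chart_comp_of_injOn_ofReal` ∘ ✓`prod_volume_eq_map_diagScale` ∘ ✓`volume_withDensity_eq_map_gnoFibreEquiv`);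
* §4 `integral_comp_gnoScale` (Bochner change of variables under the rescaling, ✓`lintegral_comp_diagScale`), `rescaledWeight_facts` (`w₀ = (1+x₀²)⁻¹(1+y₀²)⁻¹` positive,
  measurable, integrable on `ℝ²`) and ★★★ `gnoFibre_rescaled_sockets` — operators `A′_p = D_pA_pD_p` (symmetric, measurable, ray identity `⟪A′y,y⟫ = Q_p(D_p y)`, uniform
  coercivity `ψ₀∕(82944L¹⁰)`), cubic datum `1242000L⁴‖y‖³` (✓`rescaled_cubic_flat`), amplitude `J·1 = w₀(p)(1+e′)`, `|e′| ≤ 2R‖y‖`, and the MAIN-TERM IDENTITY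
  `w₀(p)∕√det A′_p = 𝔪(a,ε,p)` (✓`mbDensity`; ✓`mbDensity_eq_of_coercive` + `integral_comp_gnoScale`) — the `hA hcoer hAm hρ hη hf hw` of
  ✓`laplaceMethod_quantitative_fibred_chart_cubic_offBound` for `Ψ := Ψ′` on `M = ℝ²`.

HONEST LABEL: sockets (measure-theoretic plumbing and identities composed from landed files); the plane bulk estimate itself is the next file; S3∕S4∕S5,
⟨24197⟩ ∕ ⟨24194⟩ OPEN; own crux ⟨22884⟩ `LargeFieldMassRefinementTail` OPEN (blocked-on ⟨19935⟩); the Yang–Mills mass gap is NOT proved; no summit is proved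
by a line.  THEOREMS ONLY (0 `def`, 0 `sorry`, no instance), standard axioms.  Width seat ym-line-sfw-p2-w2 g59 (cell ym-idea-1, free hands),
`--supports stmt-QuantumFields-24197`.  References: [cite: Luscher1983, §2]; [cite: Breitung1994, §2.3 Definitions 4–5; Lemma 26 (2.102) p. 30]; [folklore].
-/

set_option autoImplicit false
set_option synthInstance.maxSize 1024

noncomputable section

open MeasureTheory Quaternion Set Metric Module
open scoped Quaternion BigOperators ENNReal InnerProductSpace
open Literature.MathematicalPhysics.QuantumLattice
open Literature.MathematicalPhysics.QuantumFieldTheory hiding SU2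

namespace Summit.QuantumFields.YangMills.Theorems.SwapVirialDeficit.BlowUpRing

open Summit.QuantumFields.YangMills.Theorems.FemtoTransferGap
open Summit.QuantumFields.YangMills.Theorems.FemtoTransferGap.TT
open Summit.QuantumFields.YangMills.Theorems.VirialFluxGap.RingDeficit
open Summit.QuantumFields.YangMills.Theorems.SwapVirialDeficit.SwapRing
open Summit.QuantumFields.YangMills.Theorems.SwapVirialDeficit.SectorLaplace (fibQ z₀ mbDensity alpha measurable_fibQ)
open Summit.QuantumFields.YangMills.Theorems.SwapVirialDeficit.Gnomonic (normSq3 normSq3_nonneg)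
open Summit.QuantumFields.YangMills.Theorems.QuantitativeLaplace (lintegral_comp_diagScale prod_volume_eq_map_diagScale diagScale_injective
  measurableSet_image_diagScale restrict_image_eq_map_of_eq_map)

variable {L : ℕ} [NeZero L]

/-! ## §3 The rescaled chart and its tube chart identity -/

/-- The rescaled chart `Ψ′(p, y) = gnoFibreEquiv (p, gnoScale p y)` is measurable. [folklore] -/
theorem measurable_gnoScaleChart : Measurable fun q : (ℝ × ℝ) × GnoFibre L => gnoFibreEquiv (q.1, gnoScale q.1 q.2) := by
  have h := Measurable.comp (measurable_gnoFibreEquiv (L := L)) (measurable_fst.prodMk (measurable_gnoScale_prod (L := L)))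
  exact h

/-- `Ψ′` is injective. [folklore] -/
theorem gnoScaleChart_injective : Function.Injective fun q : (ℝ × ℝ) × GnoFibre L => gnoFibreEquiv (q.1, gnoScale q.1 q.2) := by
  intro q q' h
  have h1 : (q.1, gnoScale q.1 q.2) = (q'.1, gnoScale q'.1 q'.2) := (gnoFibreEquiv (L := L)).injective h
  exact diagScale_injective (c := fun (p : ℝ × ℝ) (i : GnoFibreIdx L) => gnoFibreScale (L := L) p i) (fun p i => (gnoFibreScale_pos p i).ne') h1

/-- `Ψ′` is surjective (each `D_p` is invertible). [folklore] -/
theorem gnoScaleChart_surjective : Function.Surjective fun q : (ℝ × ℝ) × GnoFibre L => gnoFibreEquiv (q.1, gnoScale q.1 q.2) := by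
  intro η
  obtain ⟨⟨p, y'⟩, rfl⟩ := (gnoFibreEquiv (L := L)).surjective η
  refine ⟨(p, (WithLp.toLp 2 fun i => (gnoFibreScale p i)⁻¹ * y' i : GnoFibre L)), ?_⟩
  show gnoFibreEquiv (p, gnoScale p (WithLp.toLp 2 fun i => (gnoFibreScale p i)⁻¹ * y' i : GnoFibre L)) = gnoFibreEquiv (p, y')
  congr 2
  exact PiLp.ext fun i => by rw [gnoScale_apply, PiLp.toLp_apply, mul_inv_cancel_left₀ (gnoFibreScale_pos p i).ne']

/-- ★ **THE TUBE CHART IDENTITY OF THE RESCALED CHART** over a measurable base set `S`: the tube image `Ψ′(S × B̄_R)` is measurable and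
`(vol·ρ)|_{Ψ′(S × B̄_R)} = Ψ′_*(((vol ⊗ vol)|_{S × B̄_R})·J)` with `J(p,y) = (Π_i|c_i(p)|)·ρ(Ψ′(p,y))` — lit ✓`chart_comp_of_injOn_ofReal` applied to
✓`volume_withDensity_eq_map_gnoFibreEquiv` (outer chart, `Ω = univ`) and ✓`prod_volume_eq_map_diagScale` (fibrewise rescaling). [cite: Breitung1994, §2.3 Definitions 4–5] -/
theorem volume_gnoDensity_restrict_scaledTube_eq_map {S : Set (ℝ × ℝ)} (hS : MeasurableSet S) (R : ℝ) :
    MeasurableSet ((fun q : (ℝ × ℝ) × GnoFibre L => gnoFibreEquiv (q.1, gnoScale q.1 q.2)) '' (S ×ˢ closedBall (0 : GnoFibre L) R)) ∧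
    ((volume : Measure (GnoCoord L)).withDensity (fun η => ENNReal.ofReal (gnoDensity η))).restrict
        ((fun q : (ℝ × ℝ) × GnoFibre L => gnoFibreEquiv (q.1, gnoScale q.1 q.2)) '' (S ×ˢ closedBall (0 : GnoFibre L) R)) =
      ((((volume : Measure (ℝ × ℝ)).prod (volume : Measure (GnoFibre L))).restrict (S ×ˢ closedBall (0 : GnoFibre L) R)).withDensity
        (fun q => ENNReal.ofReal ((∏ i, |gnoFibreScale (L := L) q.1 i|) * gnoDensity (gnoFibreEquiv (q.1, gnoScale q.1 q.2))))).map
        (fun q : (ℝ × ℝ) × GnoFibre L => gnoFibreEquiv (q.1, gnoScale q.1 q.2)) := by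
  classical
  set Φ : (ℝ × ℝ) × GnoFibre L → (ℝ × ℝ) × GnoFibre L :=
    fun q => (q.1, (WithLp.toLp 2 fun i => gnoFibreScale q.1 i * q.2 i : GnoFibre L)) with hΦ
  have hc : ∀ i, Measurable fun p : ℝ × ℝ => gnoFibreScale (L := L) p i := measurable_gnoFibreScale
  have hc0 : ∀ (p : ℝ × ℝ) (i : GnoFibreIdx L), gnoFibreScale (L := L) p i ≠ 0 := fun p i => (gnoFibreScale_pos p i).ne'
  have hΦm : Measurable Φ := QuantitativeLaplace.measurable_diagScale hc
  have hW : MeasurableSet (S ×ˢ closedBall (0 : GnoFibre L) R) := hS.prod measurableSet_closedBall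
  have hΦW : MeasurableSet (Φ '' (S ×ˢ closedBall (0 : GnoFibre L) R)) := measurableSet_image_diagScale hc hc0 hW
  have hEΦW : MeasurableSet (gnoFibreEquiv '' (Φ '' (S ×ˢ closedBall (0 : GnoFibre L) R))) :=
    (gnoFibreEquiv (L := L)).measurableEmbedding.measurableSet_image.2 hΦW
  have hcomp : (fun q : (ℝ × ℝ) × GnoFibre L => gnoFibreEquiv (q.1, gnoScale q.1 q.2)) = (gnoFibreEquiv (L := L)) ∘ Φ := rfl
  -- the outer chart, `Ω = univ`
  have hΘ : ((volume : Measure (GnoCoord L)).withDensity (fun η => ENNReal.ofReal (gnoDensity η))).restrict (gnoFibreEquiv '' (univ : Set ((ℝ × ℝ) × GnoFibre L))) =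
      ((((volume : Measure (ℝ × ℝ)).prod (volume : Measure (GnoFibre L))).restrict univ).withDensity
        fun v => ENNReal.ofReal (gnoDensity (gnoFibreEquiv v))).map (gnoFibreEquiv (L := L)) := by
    rw [image_univ_of_surjective (gnoFibreEquiv (L := L)).surjective, Measure.restrict_univ, Measure.restrict_univ]
    exact volume_withDensity_eq_map_gnoFibreEquiv (ENNReal.measurable_ofReal.comp measurable_gnoDensity)
  -- the fibrewise rescaling chart
  have hΨ : ((volume : Measure (ℝ × ℝ)).prod (volume : Measure (GnoFibre L))).restrict (Φ '' (S ×ˢ closedBall (0 : GnoFibre L) R)) =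
      ((((volume : Measure (ℝ × ℝ)).prod (volume : Measure (GnoFibre L))).restrict (S ×ˢ closedBall (0 : GnoFibre L) R)).withDensity
        fun q => ENNReal.ofReal (∏ i, |gnoFibreScale (L := L) q.1 i|)).map Φ :=
    restrict_image_eq_map_of_eq_map hΦm (diagScale_injective hc0) (prod_volume_eq_map_diagScale (volume : Measure (ℝ × ℝ)) hc hc0) hW hΦW
  have key := Literature.Analysis.Asymptotics.chart_comp_of_injOn_ofReal
    (μ := (volume : Measure (GnoCoord L)).withDensity fun η => ENNReal.ofReal (gnoDensity η))
    (κ := (volume : Measure (ℝ × ℝ)).prod (volume : Measure (GnoFibre L))) (ν := (volume : Measure (ℝ × ℝ)).prod (volume : Measure (GnoFibre L)))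
    (Θ := gnoFibreEquiv (L := L)) (Ω := univ) (J₁ := fun v => gnoDensity (gnoFibreEquiv v)) (Ψ := Φ) (W := S ×ˢ closedBall (0 : GnoFibre L) R)
    (J₂ := fun q => ∏ i, |gnoFibreScale (L := L) q.1 i|)
    measurable_gnoFibreEquiv hΦm (gnoFibreEquiv (L := L)).injective.injOn (measurable_gnoDensity.comp measurable_gnoFibreEquiv)
    (Finset.measurable_prod _ fun i _ => ((hc i).comp measurable_fst).abs) (fun q => Finset.prod_nonneg fun i _ => abs_nonneg _) (subset_univ _) hEΦW hΘ hΨ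
  rw [hcomp]
  refine ⟨by rw [image_comp]; exact hEΦW, ?_⟩
  exact key

/-! ## §4 The Bochner change of variables and the packaged sockets -/

/-- ★ **Bochner change of variables under the rescaling**: for measurable `g ≥ 0`, `∫ g = (1+x₀²)(1+y₀²)·∫ g ∘ gnoScale p` (✓`lintegral_comp_diagScale`). [folklore] -/
theorem integral_comp_gnoScale (p : ℝ × ℝ) {g : GnoFibre L → ℝ} (hg : Measurable g) (hg0 : ∀ y, 0 ≤ g y) :
    ∫ y, g y = (1 + p.1 ^ 2) * (1 + p.2 ^ 2) * ∫ y, g (gnoScale p y) := by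
  classical
  have hc0 : ∀ i, gnoFibreScale (L := L) p i ≠ 0 := fun i => (gnoFibreScale_pos p i).ne'
  have hpy : Measurable fun y : GnoFibre L => (p, y) := measurable_const.prodMk measurable_id
  have hSm : Measurable fun y : GnoFibre L => gnoScale p y := by
    have h := Measurable.comp (measurable_gnoScale_prod (L := L)) hpy
    exact h
  have hgS : Measurable fun y : GnoFibre L => g (gnoScale p y) := by
    have h := Measurable.comp hg hSm
    exact h
  have hl := lintegral_comp_diagScale (gnoFibreScale p) hc0 hg.ennreal_ofReal
  rw [prod_abs_gnoFibreScale] at hl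
  rw [integral_eq_lintegral_of_nonneg_ae (Filter.Eventually.of_forall hg0) hg.aestronglyMeasurable,
    integral_eq_lintegral_of_nonneg_ae (Filter.Eventually.of_forall fun y => hg0 _) hgS.aestronglyMeasurable, hl,
    ENNReal.toReal_mul, ENNReal.toReal_ofReal (by positivity)]
  rfl

/-- The rescaled base weight `w₀(p) = (1+x₀²)⁻¹(1+y₀²)⁻¹` is positive, measurable and integrable on `ℝ²`. [folklore] -/
theorem rescaledWeight_facts :
    (∀ p : ℝ × ℝ, 0 < (1 + p.1 ^ 2)⁻¹ * (1 + p.2 ^ 2)⁻¹) ∧ (Measurable fun p : ℝ × ℝ => (1 + p.1 ^ 2)⁻¹ * (1 + p.2 ^ 2)⁻¹) ∧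
      Integrable (fun p : ℝ × ℝ => (1 + p.1 ^ 2)⁻¹ * (1 + p.2 ^ 2)⁻¹) := by
  refine ⟨fun p => by positivity, ?_, ?_⟩
  · exact ((measurable_const.add (measurable_fst.pow_const 2)).inv).mul ((measurable_const.add (measurable_snd.pow_const 2)).inv)
  · exact integrable_inv_one_add_sq.mul_prod integrable_inv_one_add_sq

/-- ★★★ **THE RESCALED BULK SOCKETS, principal sector, bulk hub** (`a ≠ 0`, `ψ₀ ≤ sin²2ψ`, `ψ₀ ≤ sin²ψ`, `0 < ψ₀ ≤ 1`, `ε_z = +`, followers `+`): operators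
`A′_p = D_p A_p D_p` (symmetric; `(p,y) ↦ ⟪A′_p y,y⟫` measurable; RAY IDENTITY `⟪A′_p y, y⟫ = Q_{a,ε,p}(gnoScale p y)`; UNIFORM COERCIVITY `ψ₀∕(82944L¹⁰)·‖y‖² ≤ ⟪A′_p y,y⟫`),
the cubic datum `F̂(Ψ′(p,y)) − 0 = ½⟪A′_p y,y⟫ + ρ′(p,y)`, `|ρ′| ≤ 1242000L⁴‖y‖³` (all `y`), the amplitude `J(p,y)·1 = w₀(p)(1 + e′(p,y))` with `J = (Π|c_i(p)|)·ρ(Ψ′(p,y))`,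
`w₀ = (1+x₀²)⁻¹(1+y₀²)⁻¹`, `|e′| ≤ 2R‖y‖` on `‖y‖ ≤ R`, and THE MAIN-TERM IDENTITY `w₀(p)∕√det A′_p = 𝔪(a,ε,p)` — the `hA hcoer hAm hρ hη hf hw` of
✓`laplaceMethod_quantitative_fibred_chart_cubic_offBound` for `Ψ := Ψ′`, uniform on `M = ℝ²`. [cite: Luscher1983, §2] [cite: Breitung1994, Lemma 26 (2.102), p. 30] -/
theorem gnoFibre_rescaled_sockets {a : ℍ} (ha : a ≠ 0) (ε : GnoSign L) (hz : ε.2.1 = true) (hε : ε.2.2 = fun _ => true)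
    {ψ₀ : ℝ} (hψ₀ : 0 < ψ₀) (hψ₁ : ψ₀ ≤ 1) (hS1 : ψ₀ ≤ (2 * (‖a‖⁻¹ * a.re) * (‖a‖⁻¹ * ‖a.im‖)) ^ 2) (hS2 : ψ₀ ≤ (‖a‖⁻¹ * ‖a.im‖) ^ 2) :
    ∃ A' : ℝ × ℝ → GnoFibre L →ₗ[ℝ] GnoFibre L, ∃ ρ' e' : (ℝ × ℝ) × GnoFibre L → ℝ,
      (∀ p, (A' p).IsSymmetric) ∧
      (Measurable fun q : (ℝ × ℝ) × GnoFibre L => ⟪A' q.1 q.2, q.2⟫_ℝ) ∧ Measurable ρ' ∧ Measurable e' ∧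
      (∀ p (y : GnoFibre L), ⟪A' p y, y⟫_ℝ = fibQ a ε p (gnoScale p y)) ∧
      (∀ p (y : GnoFibre L), ψ₀ / (82944 * (L : ℝ) ^ 10) * ‖y‖ ^ 2 ≤ ⟪A' p y, y⟫_ℝ) ∧
      (∀ p (y : GnoFibre L), gnoDeficit (fun _ => false) (fun _ => 1) a ε (gnoFibreEquiv (p, gnoScale p y)) - 0 = (1 / 2) * ⟪A' p y, y⟫_ℝ + ρ' (p, y)) ∧
      (∀ p (y : GnoFibre L), |ρ' (p, y)| ≤ 1242000 * (L : ℝ) ^ 4 * ‖y‖ ^ 3) ∧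
      (∀ p (y : GnoFibre L), (∏ i, |gnoFibreScale (L := L) p i|) * gnoDensity (gnoFibreEquiv (p, gnoScale p y)) * 1 =
        (1 + p.1 ^ 2)⁻¹ * (1 + p.2 ^ 2)⁻¹ * (1 + e' (p, y))) ∧
      (∀ R : ℝ, 0 ≤ R → ∀ p (y : GnoFibre L), ‖y‖ ≤ R → |e' (p, y)| ≤ (2 * R) * ‖y‖) ∧
      (∀ p, (1 + p.1 ^ 2)⁻¹ * (1 + p.2 ^ 2)⁻¹ / Real.sqrt (LinearMap.det (A' p)) = mbDensity a ε p) := by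
  obtain ⟨A, -, -, hAs, hAm, -, -, hray, -⟩ := gnoFibre_bulk_sockets (L := L) ha ε hz hε
  have hL : (0 : ℝ) < (L : ℝ) := by exact_mod_cast NeZero.pos L
  have hlam : 0 < ψ₀ / (82944 * (L : ℝ) ^ 10) := by positivity
  have hD := fun p => gnoScaleLin_isSymmetric (L := L) p
  -- the conjugated operators
  refine ⟨fun p => (gnoScaleLin p).comp ((A p).comp (gnoScaleLin p)),
    fun q => gnoDeficit (fun _ => false) (fun _ => 1) a ε (gnoFibreEquiv (q.1, gnoScale q.1 q.2)) - (1 / 2) * ⟪A q.1 (gnoScale q.1 q.2), gnoScale q.1 q.2⟫_ℝ,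
    fun q => gnoDensity (gnoFibreEmb q.2) - 1, ?_⟩
  have hA'yy : ∀ p (y : GnoFibre L), ⟪((gnoScaleLin p).comp ((A p).comp (gnoScaleLin p))) y, y⟫_ℝ = ⟪A p (gnoScale p y), gnoScale p y⟫_ℝ := fun p y => by
    show ⟪gnoScaleLin p (A p (gnoScaleLin p y)), y⟫_ℝ = _
    rw [hD p, gnoScaleLin_apply]
  have hrayQ : ∀ p (y : GnoFibre L), ⟪A p (gnoScale p y), gnoScale p y⟫_ℝ = fibQ a ε p (gnoScale p y) := fun p y => by
    rw [hray]; rfl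
  -- measurability of the conjugated form
  have hG : Measurable fun q : (ℝ × ℝ) × GnoFibre L => (q.1, gnoScale q.1 q.2) := measurable_fst.prodMk (measurable_gnoScale_prod (L := L))
  have hAm' : Measurable fun q : (ℝ × ℝ) × GnoFibre L => ⟪A q.1 (gnoScale q.1 q.2), gnoScale q.1 q.2⟫_ℝ := by
    have h := Measurable.comp hAm hG
    exact h
  have hFm : Measurable fun q : (ℝ × ℝ) × GnoFibre L => gnoDeficit (fun _ => false) (fun _ => 1) a ε (gnoFibreEquiv (q.1, gnoScale q.1 q.2)) := by
    have h := Measurable.comp (measurable_gnoDeficit (fun _ => false) (fun _ => 1) a ε) (measurable_gnoScaleChart (L := L))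
    exact h
  have hEm : Measurable fun q : (ℝ × ℝ) × GnoFibre L => gnoDensity (gnoFibreEmb q.2) := by
    have h := Measurable.comp measurable_gnoDensity ((gnoFibreEmb (L := L)).continuous.measurable.comp (measurable_snd : Measurable fun q : (ℝ × ℝ) × GnoFibre L => q.2))
    exact h
  refine ⟨?_, ?_, hFm.sub (measurable_const.mul hAm'), hEm.sub measurable_const, fun p y => by rw [hA'yy, hrayQ], fun p y => ?_, fun p y => ?_, fun p y => ?_,
    fun p y => ?_, fun R hR p y hy => ?_, fun p => ?_⟩
  · -- symmetry of `D A D`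
    intro p x y
    show ⟪gnoScaleLin p (A p (gnoScaleLin p x)), y⟫_ℝ = ⟪x, gnoScaleLin p (A p (gnoScaleLin p y))⟫_ℝ
    rw [hD p, hAs p, hD p]
  · -- measurability
    have e : (fun q : (ℝ × ℝ) × GnoFibre L => ⟪((gnoScaleLin q.1).comp ((A q.1).comp (gnoScaleLin q.1))) q.2, q.2⟫_ℝ) =
        fun q => ⟪A q.1 (gnoScale q.1 q.2), gnoScale q.1 q.2⟫_ℝ := funext fun q => hA'yy q.1 q.2
    rw [e]; exact hAm'
  · -- uniform coercivity
    rw [hA'yy, hrayQ]; exact fibQ_gnoScale_ge ha ε hz hε hψ₀ hψ₁ hS1 hS2 p y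
  · -- `hf`: an identity
    rw [hA'yy]; ring
  · -- `hρ`: the rescaled cubic datum
    show |gnoDeficit (fun _ => false) (fun _ => 1) a ε (gnoFibreEquiv (p, gnoScale p y)) - (1 / 2) * ⟪A p (gnoScale p y), gnoScale p y⟫_ℝ| ≤ _
    rw [hrayQ]; exact rescaled_cubic_flat ha ε hz hε p y
  · -- `hw`: the amplitude factorises
    show (∏ i, |gnoFibreScale (L := L) p i|) * gnoDensity (gnoFibreEquiv (p, gnoScale p y)) * 1 = (1 + p.1 ^ 2)⁻¹ * (1 + p.2 ^ 2)⁻¹ * (1 + (gnoDensity (gnoFibreEmb y) - 1))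
    rw [prod_abs_gnoFibreScale, gnoDensity_rescaled_eq, ← gnoDensity_gnoBase_mul_jacobian (L := L) p]; ring
  · -- `hη`: the amplitude defect
    show |gnoDensity (gnoFibreEmb y) - 1| ≤ 2 * R * ‖y‖
    obtain ⟨h1, h2⟩ := gnoDensity_gnoFibreEmb_bounds (L := L) y
    rw [abs_le]
    have hy0 := norm_nonneg y
    constructor <;> nlinarith [mul_le_mul_of_nonneg_left hy (by positivity : (0 : ℝ) ≤ 2 * ‖y‖)]
  · -- the main-term identity
    have hco : ∀ y : GnoFibre L, ψ₀ / (82944 * (L : ℝ) ^ 10) * ‖y‖ ^ 2 ≤ ⟪((gnoScaleLin p).comp ((A p).comp (gnoScaleLin p))) y, y⟫_ℝ := fun y => by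
      rw [hA'yy, hrayQ]; exact fibQ_gnoScale_ge ha ε hz hε hψ₀ hψ₁ hS1 hS2 p y
    have hsym : ((gnoScaleLin p).comp ((A p).comp (gnoScaleLin (L := L) p))).IsSymmetric := by
      intro x y
      show ⟪gnoScaleLin p (A p (gnoScaleLin p x)), y⟫_ℝ = ⟪x, gnoScaleLin p (A p (gnoScaleLin p y))⟫_ℝ
      rw [hD p, hAs p, hD p]
    have h1 := mbDensity_eq_of_coercive hsym hlam hco (Q := fun y => fibQ a ε p (gnoScale p y)) (fun y => by rw [hA'yy, hrayQ]) ((1 + p.1 ^ 2)⁻¹ * (1 + p.2 ^ 2)⁻¹)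
    have hgm : Measurable fun y : GnoFibre L => Real.exp (-(fibQ a ε p y / 2)) := ((measurable_fibQ ha ε p).div_const 2).neg.exp
    have h2 := integral_comp_gnoScale (L := L) p hgm (fun y => (Real.exp_pos _).le)
    rw [h1]
    unfold mbDensity alpha
    rw [h2, ← gnoDensity_gnoBase_mul_jacobian (L := L) p]
    have hx : (1 : ℝ) + p.1 ^ 2 ≠ 0 := by positivity
    have hy : (1 : ℝ) + p.2 ^ 2 ≠ 0 := by positivity
    field_simp

end Summit.QuantumFields.YangMills.Theorems.SwapVirialDeficit.BlowUpRing

end
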